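import Literature.MathematicalPhysics.QuantumLattice.PeierlsHoppingGaugeFunctionBound
import HarnessLib

/-!
# Bounds node: the PTR gauge-function bound for NUMBER-CONSERVING (not necessarily diagonal) interactions

HONEST FRAMING: ladder R1–R4 with certified numbers; no claim on H/H₀. This file states BOUNDS FOR
A MODEL CLASS (no materials claim) and proves them; nothing here is a cited fact.

Cell `pub-hubbard`, unit `pub-hubbard-bounds` (gen 8), `paper/bounds.tex` Theorem 4 (first
inequality, exact `1 − cos` form). The Literature file `PeierlsHoppingGaugeFunctionBound.lean`
(Paramekanti–Trivedi–Randeria 1998 §IV, verbatim class of their §II) covers every OCCUPATION-DIAGONAL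
interaction `V̂`. The class `𝔥` of `bounds.tex` Definition 1 is wider: `V` Hermitian with
`[V, n_x] = 0` for every site `x` (Heisenberg / Kondo exchange, transverse Zeeman fields, … are
number-conserving site by site but not diagonal). The PTR argument uses only three properties of `V`,
which are the hypotheses of the two nodes below (over the tree's `bdgHopping`, `phaseGauge`,
`partitionFn`, `gibbsState`, `minEnergyOn`, `szSector`; no new definition besides the node `Prop`s):
* `V.IsHermitian`;
* `V.map conj = V` — `V` is real in the occupation basis (time reversal; true for density–density,
  `S_x·S_y`, `S^x`, `S^z` couplings; it EXCLUDES e.g. a transverse field along `y`);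
* `W_φᴴ V W_φ = V` for every gauge function `φ : Λ → ℝ`, `W_φ = phaseGauge (x ↦ e^{iφ(x)})` — the
  integrated form of `[V, n_x] = 0 ∀ x` (equivalent to it, since the `W_φ` are exactly the unitaries
  generated by the `n_x`; the equivalence is not needed and not proved here).
Setting: `Λ` any finite linearly ordered site set; `t : Λ → Λ → ℝ` symmetric real hopping data (any
sign, any range: an arbitrary hopping graph; `t_{xy} = −t_b` of `bounds.tex`); `u : Λ → Λ → ℝ`
antisymmetric bond phases (e.g. `u_b = A d_{b,1}`, a seam twist, any inserted flux);
`H(u) = bdgHopping (t e^{iu}) + V`, `H₀ = bdgHopping t + V`.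

## Nodes (all THEOREMS, `_holds` proved below, sorry-free)

* `ThermalGaugeFunctionBoundNumberConserving` (`T > 0`, every coordinate sector `p`, every `β`, every
  `φ`): `log Z_p(H₀) + β Σ_{x,y,σ} t_{xy} (1 − cos(u_{xy} + φ_y − φ_x)) Re⟨(c†_{xσ} c_{yσ})|_p⟩_{β,p} ≤ log Z_p(H(u))`,
  i.e. `F_p(u) − F_p(0) ≤ Σ_b κ_b(β,p) (1 − cos(u_b + dφ_b))` with EXACT thermal bond weights.
* `GaugeFunctionBoundNumberConserving` (`T = 0`, every joint sector `(N, S^z = M)`, every unit sector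
  ground state `ψ` of `H₀`, every `φ`):
  `E_{N,M}(H(u)) − E_{N,M}(H₀) ≤ −Σ_{x,y,σ} t_{xy} (1 − cos(u_{xy} + φ_y − φ_x)) Re⟨ψ, c†_{xσ} c_{yσ} ψ⟩`.
* `OccupationDiagonalIsNumberConserving` (bookkeeping edge): every real `diagonal Φ` satisfies the three
  hypotheses, so these nodes contain the Literature theorems.
Proof route: exactly the Literature file's (Peierls–Bogoliubov resp. Rayleigh at `±u` in the gauge
`u + dφ`, time reversal, the operator midpoint identity `bdgHopping_peierls_add_peierls_neg_add`), with
the hopping-part facts imported at `Φ = 0` and the three hypotheses replacing diagonality of `V`.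

References: [ParamekantiTrivediRanderia1998] §II, §IV; [HazraVermaRanderia2019] eq. (2) and the
class "interactions that commute with the local density"; [KomaTasakiPRL1992] eq. (7).
-/

noncomputable section

namespace Summit.HubbardSuperconductivity.HubbardLadder.Bounds

open Matrix Finset Literature.MathematicalPhysics.QuantumLattice
  Literature.MathematicalPhysics.QuantumFieldTheory

open scoped ComplexConjugate ComplexOrder

/-- **Node (THEOREM, proved below): the PTR gauge-function bound at `T > 0` for number-conserving
interactions.** For every finite site set, symmetric real hopping `t`, antisymmetric bond phases `u`,
every `V` that is Hermitian, real in the occupation basis and invariant under every site-phase gauge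
`W_φ`, every `β`, every coordinate sector `p` and every gauge function `φ`:
`log Z_p(H₀) + β Σ_{x,y,σ} t_{xy}(1 − cos(u_{xy} + φ_y − φ_x)) Re⟨(c†_{xσ}c_{yσ})|_p⟩_{β,p} ≤ log Z_p(H(u))`.
HONEST FRAMING: a bound for a model class; no claim on H/H₀. -/
@[conjecture] def ThermalGaugeFunctionBoundNumberConserving : Prop :=
  ∀ (Λ : Type) [LinearOrder Λ] [Fintype Λ] (t u : Λ → Λ → ℝ), (∀ x y, t y x = t x y) →
    (∀ x y, u y x = -u x y) → ∀ (V : Matrix (Finset (Orb Λ)) (Finset (Orb Λ)) ℂ), V.IsHermitian →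
    V.map (starRingEnd ℂ) = V →
    (∀ φ : Λ → ℝ, (phaseGauge fun x => Circle.exp (φ x))ᴴ * V * phaseGauge (fun x => Circle.exp (φ x)) = V) →
    ∀ (β : ℝ) (p : Finset (Orb Λ) → Prop) [Fintype {a // p a}] [DecidableEq {a // p a}] (φ : Λ → ℝ),
      Real.log (partitionFn β ((bdgHopping (fun x y => (t x y : ℂ)) + V).toBlock p p)).re +
          β * ∑ x : Λ, ∑ y : Λ, ∑ σ : Fin 2, t x y * (1 - Real.cos (u x y + (φ y - φ x))) *
            (gibbsState β ((bdgHopping (fun x y => (t x y : ℂ)) + V).toBlock p p)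
              ((creation (orb x σ) * annihilation (orb y σ)).toBlock p p)).re ≤
        Real.log (partitionFn β
          ((bdgHopping (fun x y => (t x y : ℂ) * Complex.exp ((u x y : ℂ) * Complex.I)) + V).toBlock p p)).re

/-- **Node (THEOREM, proved below): the PTR gauge-function bound at `T = 0` for number-conserving
interactions.** Same class; for every joint sector `(N, S^z = M)`, every unit sector ground state `ψ`
of `H₀` and every gauge function `φ`:
`E_{N,M}(H(u)) − E_{N,M}(H₀) ≤ −Σ_{x,y,σ} t_{xy}(1 − cos(u_{xy} + φ_y − φ_x)) Re⟨ψ, c†_{xσ}c_{yσ}ψ⟩`.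
HONEST FRAMING: a bound for a model class; no claim on H/H₀. -/
@[conjecture] def GaugeFunctionBoundNumberConserving : Prop :=
  ∀ (Λ : Type) [LinearOrder Λ] [Fintype Λ] (t u : Λ → Λ → ℝ), (∀ x y, t y x = t x y) →
    (∀ x y, u y x = -u x y) → ∀ (V : Matrix (Finset (Orb Λ)) (Finset (Orb Λ)) ℂ), V.IsHermitian →
    V.map (starRingEnd ℂ) = V →
    (∀ φ : Λ → ℝ, (phaseGauge fun x => Circle.exp (φ x))ᴴ * V * phaseGauge (fun x => Circle.exp (φ x)) = V) →
    ∀ (N : ℕ) (M : ℝ) (ψ : Fock (Orb Λ)),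
      IsGroundStateInSector ((bdgHopping fun x y => (t x y : ℂ)) + V) N M ψ → star ψ ⬝ᵥ ψ = 1 →
      ∀ φ : Λ → ℝ,
        ((bdgHopping fun x y => (t x y : ℂ) * Complex.exp ((u x y : ℂ) * Complex.I)) + V).minEnergyOn
              (szSector N M) -
            ((bdgHopping fun x y => (t x y : ℂ)) + V).minEnergyOn (szSector N M) ≤
          -∑ x : Λ, ∑ y : Λ, ∑ σ : Fin 2, t x y * (1 - Real.cos (u x y + (φ y - φ x))) *
            (star ψ ⬝ᵥ ((creation (orb x σ) * annihilation (orb y σ)) *ᵥ ψ)).re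

/-! ### The hopping part alone (the Literature facts at `Φ = 0`) -/

section Hopping

variable {Λ : Type} [LinearOrder Λ] [Fintype Λ]

/-- `T(u)` is Hermitian (symmetric real `t`, antisymmetric `u`). -/
theorem isHermitian_bdgHopping_peierls {t u : Λ → Λ → ℝ} (ht : ∀ x y, t y x = t x y)
    (hu : ∀ x y, u y x = -u x y) :
    (bdgHopping fun x y => (t x y : ℂ) * Complex.exp ((u x y : ℂ) * Complex.I)).IsHermitian := by
  have h := isHermitian_bdgHopping_peierls_add_diagonal ht hu 0
  simp only [Pi.zero_apply, Complex.ofReal_zero, diagonal_zero, add_zero] at h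
  exact h

/-- Time reversal of the hopping part: `conj T(u) = T(−u)`. -/
theorem bdgHopping_peierls_map_conj (t u : Λ → Λ → ℝ) :
    (bdgHopping fun x y => (t x y : ℂ) * Complex.exp ((u x y : ℂ) * Complex.I)).map (starRingEnd ℂ) =
      bdgHopping fun x y => (t x y : ℂ) * Complex.exp (((-u x y : ℝ) : ℂ) * Complex.I) := by
  have h := bdgHopping_peierls_add_diagonal_map_conj t u 0
  simp only [Pi.zero_apply, Complex.ofReal_zero, diagonal_zero, add_zero] at h
  exact h

/-- Gauge covariance of the hopping part: `W_φᴴ T(u) W_φ = T(u + dφ)`. -/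
theorem conjTranspose_phaseGauge_mul_bdgHopping_peierls_mul_phaseGauge (t u : Λ → Λ → ℝ)
    (φ : Λ → ℝ) :
    (phaseGauge fun x => Circle.exp (φ x))ᴴ *
        bdgHopping (fun x y => (t x y : ℂ) * Complex.exp ((u x y : ℂ) * Complex.I)) *
        phaseGauge (fun x => Circle.exp (φ x)) =
      bdgHopping fun x y => (t x y : ℂ) * Complex.exp (((u x y + (φ y - φ x) : ℝ) : ℂ) * Complex.I) := by
  have h := conjTranspose_phaseGauge_mul_bdgHopping_peierls_add_diagonal_mul_phaseGauge t u 0 φ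
  simp only [Pi.zero_apply, Complex.ofReal_zero, diagonal_zero, add_zero] at h
  exact h

/-- `Re⟨v, T(w) v⟩ = Σ_{x,y,σ} w_{xy} Re⟨v, c†_{xσ} c_{yσ} v⟩` for real weights `w`. -/
theorem re_star_dotProduct_bdgHopping_real_mulVec (w : Λ → Λ → ℝ) (v : Fock (Orb Λ)) :
    (star v ⬝ᵥ (bdgHopping (fun x y => ((w x y : ℝ) : ℂ)) *ᵥ v)).re =
      ∑ x : Λ, ∑ y : Λ, ∑ σ : Fin 2,
        w x y * (star v ⬝ᵥ ((creation (orb x σ) * annihilation (orb y σ)) *ᵥ v)).re := by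
  simp only [bdgHopping, Matrix.sum_mulVec, smul_mulVec, dotProduct_sum, dotProduct_smul, smul_eq_mul,
    Complex.re_sum, Complex.re_ofReal_mul]

/-- `Re⟨T(w)|_p⟩_{β} = Σ_{x,y,σ} w_{xy} Re⟨(c†_{xσ} c_{yσ})|_p⟩_{β}` in the Gibbs state of any block `B`. -/
theorem re_gibbsState_toBlock_bdgHopping_real (w : Λ → Λ → ℝ) (β : ℝ) (p : Finset (Orb Λ) → Prop)
    [Fintype {a // p a}] [DecidableEq {a // p a}] (B : Matrix {a // p a} {a // p a} ℂ) :
    (gibbsState β B ((bdgHopping (fun x y => ((w x y : ℝ) : ℂ))).toBlock p p)).re =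
      ∑ x : Λ, ∑ y : Λ, ∑ σ : Fin 2,
        w x y * (gibbsState β B ((creation (orb x σ) * annihilation (orb y σ)).toBlock p p)).re := by
  have h : (bdgHopping (fun x y => ((w x y : ℝ) : ℂ))).toBlock p p =
      ∑ x : Λ, ∑ y : Λ, ∑ σ : Fin 2,
        ((w x y : ℝ) : ℂ) • (creation (orb x σ) * annihilation (orb y σ)).toBlock p p := by
    ext a b
    simp only [bdgHopping, toBlock_apply, Matrix.sum_apply, Matrix.smul_apply, smul_eq_mul]
  rw [h]
  simp only [map_sum, map_smul, smul_eq_mul, Complex.re_sum, Complex.re_ofReal_mul]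

/-! ### `H(u) = T(u) + V` for a number-conserving real Hermitian `V` -/

/-- Time reversal on a coordinate sector: `Re Z_p(H(−u)) = Re Z_p(H(u))` when `V` is real. -/
theorem re_partitionFn_toBlock_bdgHopping_peierls_add_neg (t u : Λ → Λ → ℝ)
    {V : Matrix (Finset (Orb Λ)) (Finset (Orb Λ)) ℂ} (hVc : V.map (starRingEnd ℂ) = V) (β : ℝ)
    (p : Finset (Orb Λ) → Prop) [Fintype {a // p a}] [DecidableEq {a // p a}] :
    (partitionFn β
        ((bdgHopping (fun x y => (t x y : ℂ) * Complex.exp (((-u x y : ℝ) : ℂ) * Complex.I)) + V).toBlock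
          p p)).re =
      (partitionFn β
        ((bdgHopping (fun x y => (t x y : ℂ) * Complex.exp ((u x y : ℂ) * Complex.I)) + V).toBlock p p)).re := by
  have hmap : ((bdgHopping fun x y => (t x y : ℂ) * Complex.exp ((u x y : ℂ) * Complex.I)) + V).map
      (starRingEnd ℂ) =
      (bdgHopping fun x y => (t x y : ℂ) * Complex.exp (((-u x y : ℝ) : ℂ) * Complex.I)) + V := by
    rw [Matrix.map_add _ (map_add _), bdgHopping_peierls_map_conj, hVc]
  rw [← hmap, toBlock_map, partitionFn_map_starRingEnd, Complex.conj_re]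

/-- Time reversal on a joint sector: `E_{N,M}(H(−u)) = E_{N,M}(H(u))` when `V` is real. -/
theorem minEnergyOn_szSector_bdgHopping_peierls_add_neg (t u : Λ → Λ → ℝ)
    {V : Matrix (Finset (Orb Λ)) (Finset (Orb Λ)) ℂ} (hVc : V.map (starRingEnd ℂ) = V) (N : ℕ) (M : ℝ) :
    ((bdgHopping fun x y => (t x y : ℂ) * Complex.exp (((-u x y : ℝ) : ℂ) * Complex.I)) + V).minEnergyOn
        (szSector N M) =
      ((bdgHopping fun x y => (t x y : ℂ) * Complex.exp ((u x y : ℂ) * Complex.I)) + V).minEnergyOn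
        (szSector N M) := by
  have hmap : ((bdgHopping fun x y => (t x y : ℂ) * Complex.exp ((u x y : ℂ) * Complex.I)) + V).map
      (starRingEnd ℂ) =
      (bdgHopping fun x y => (t x y : ℂ) * Complex.exp (((-u x y : ℝ) : ℂ) * Complex.I)) + V := by
    rw [Matrix.map_add _ (map_add _), bdgHopping_peierls_map_conj, hVc]
  rw [← hmap]
  exact minEnergyOn_map_conj _ _ fun ψ h => star_mem_szSector h

/-- **Flux cost of the sector free energy, arbitrary bond phases, number-conserving `V`**:
`log Z_p(H₀) + β Σ_{x,y,σ} t_{xy} (1 − cos u_{xy}) Re⟨(c†_{xσ} c_{yσ})|_p⟩_{β,p} ≤ log Z_p(H(u))`. -/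
theorem log_partitionFn_toBlock_bdgHopping_peierls_add_ge {t u : Λ → Λ → ℝ}
    (ht : ∀ x y, t y x = t x y) (hu : ∀ x y, u y x = -u x y)
    {V : Matrix (Finset (Orb Λ)) (Finset (Orb Λ)) ℂ} (hV : V.IsHermitian)
    (hVc : V.map (starRingEnd ℂ) = V) (β : ℝ) (p : Finset (Orb Λ) → Prop) [Fintype {a // p a}]
    [DecidableEq {a // p a}] :
    Real.log (partitionFn β ((bdgHopping (fun x y => (t x y : ℂ)) + V).toBlock p p)).re +
        β * ∑ x : Λ, ∑ y : Λ, ∑ σ : Fin 2, t x y * (1 - Real.cos (u x y)) *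
          (gibbsState β ((bdgHopping (fun x y => (t x y : ℂ)) + V).toBlock p p)
            ((creation (orb x σ) * annihilation (orb y σ)).toBlock p p)).re ≤
      Real.log (partitionFn β
        ((bdgHopping (fun x y => (t x y : ℂ) * Complex.exp ((u x y : ℂ) * Complex.I)) + V).toBlock p p)).re := by
  rcases isEmpty_or_nonempty {a // p a} with hp | hp
  · simp [partitionFn, Matrix.trace, gibbsState_apply]
  have hu' : ∀ x y, -u y x = -(-u x y) := fun x y => by rw [hu x y]
  have h0 : (bdgHopping fun x y => (t x y : ℂ)) =
      bdgHopping (fun x y => (t x y : ℂ) * Complex.exp (((0 : Λ → Λ → ℝ) x y : ℂ) * Complex.I)) := by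
    simp
  set H₀ := (bdgHopping fun x y => (t x y : ℂ)) + V with hH₀def
  set Hp := (bdgHopping fun x y => (t x y : ℂ) * Complex.exp ((u x y : ℂ) * Complex.I)) + V with hHpdef
  set Hm := (bdgHopping fun x y => (t x y : ℂ) * Complex.exp (((-u x y : ℝ) : ℂ) * Complex.I)) + V
    with hHmdef
  have hH₀ : H₀.IsHermitian := by
    rw [hH₀def, h0]; exact (isHermitian_bdgHopping_peierls ht (fun _ _ => by simp)).add hV
  set B₀ := H₀.toBlock p p with hB₀def
  have hB₀ : B₀.IsHermitian := hH₀.submatrix _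
  have hWp : (Hp.toBlock p p - B₀).IsHermitian :=
    (((isHermitian_bdgHopping_peierls ht hu).add hV).submatrix _).sub hB₀
  have hWm : (Hm.toBlock p p - B₀).IsHermitian :=
    (((isHermitian_bdgHopping_peierls ht hu').add hV).submatrix _).sub hB₀
  -- Peierls–Bogoliubov at the untwisted block, for `+u` and `-u`
  have hPB1 := log_partitionFn_sub_le_log_partitionFn_add hB₀ hWp β
  have hPB2 := log_partitionFn_sub_le_log_partitionFn_add hB₀ hWm β
  rw [add_sub_cancel] at hPB1 hPB2
  -- time reversal
  rw [hHmdef, re_partitionFn_toBlock_bdgHopping_peierls_add_neg t u hVc, ← hHpdef] at hPB2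
  -- the midpoint identity, compressed to the sector and evaluated in the Gibbs state
  have hmid := bdgHopping_peierls_add_peierls_neg_add t u
  have hblock : Hp.toBlock p p - B₀ + (Hm.toBlock p p - B₀) =
      -(bdgHopping (fun x y => ((2 * (t x y * (1 - Real.cos (u x y))) : ℝ) : ℂ))).toBlock p p := by
    ext a b
    have hab := congrFun (congrFun hmid a) b
    simp only [Matrix.add_apply, Matrix.smul_apply, smul_eq_mul] at hab
    simp only [hHpdef, hHmdef, hB₀def, hH₀def, toBlock_apply, Matrix.add_apply, Matrix.sub_apply,
      Matrix.neg_apply]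
    linear_combination hab
  have hsum : (gibbsState β B₀ (Hp.toBlock p p - B₀)).re + (gibbsState β B₀ (Hm.toBlock p p - B₀)).re =
      -(2 * ∑ x : Λ, ∑ y : Λ, ∑ σ : Fin 2, t x y * (1 - Real.cos (u x y)) *
        (gibbsState β B₀ ((creation (orb x σ) * annihilation (orb y σ)).toBlock p p)).re) := by
    rw [← Complex.add_re, ← map_add, hblock, map_neg, Complex.neg_re, re_gibbsState_toBlock_bdgHopping_real]
    simp only [Finset.mul_sum, mul_assoc]
  have hkey := congrArg (fun z : ℝ => β * z) hsum
  simp only [mul_add] at hkey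
  linarith

/-- **Flux cost of a sector ground-state energy, arbitrary bond phases, number-conserving `V`**:
`E_{N,M}(H(u)) − E_{N,M}(H₀) ≤ −Σ_{x,y,σ} t_{xy} (1 − cos u_{xy}) Re⟨ψ, c†_{xσ} c_{yσ} ψ⟩`. -/
theorem minEnergyOn_szSector_bdgHopping_peierls_add_sub_le {t u : Λ → Λ → ℝ}
    (ht : ∀ x y, t y x = t x y) (hu : ∀ x y, u y x = -u x y)
    {V : Matrix (Finset (Orb Λ)) (Finset (Orb Λ)) ℂ} (hV : V.IsHermitian)
    (hVc : V.map (starRingEnd ℂ) = V) (N : ℕ) (M : ℝ) {ψ : Fock (Orb Λ)}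
    (hgs : IsGroundStateInSector ((bdgHopping fun x y => (t x y : ℂ)) + V) N M ψ)
    (h1 : star ψ ⬝ᵥ ψ = 1) :
    ((bdgHopping fun x y => (t x y : ℂ) * Complex.exp ((u x y : ℂ) * Complex.I)) + V).minEnergyOn
          (szSector N M) -
        ((bdgHopping fun x y => (t x y : ℂ)) + V).minEnergyOn (szSector N M) ≤
      -∑ x : Λ, ∑ y : Λ, ∑ σ : Fin 2, t x y * (1 - Real.cos (u x y)) *
        (star ψ ⬝ᵥ ((creation (orb x σ) * annihilation (orb y σ)) *ᵥ ψ)).re := by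
  have hu' : ∀ x y, -u y x = -(-u x y) := fun x y => by rw [hu x y]
  have hsplit : ∀ τ : Λ → Λ → ℂ, (star ψ ⬝ᵥ ((bdgHopping τ + V) *ᵥ ψ)).re =
      (star ψ ⬝ᵥ (bdgHopping τ *ᵥ ψ)).re + (star ψ ⬝ᵥ (V *ᵥ ψ)).re := by
    intro τ
    rw [add_mulVec, dotProduct_add, Complex.add_re]
  have hp := minEnergyOn_le_rayleigh_of_mem ((isHermitian_bdgHopping_peierls ht hu).add hV) _ hgs.1 h1
  have hm := minEnergyOn_le_rayleigh_of_mem ((isHermitian_bdgHopping_peierls ht hu').add hV) _ hgs.1 h1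
  rw [minEnergyOn_szSector_bdgHopping_peierls_add_neg t u hVc, hsplit] at hm
  rw [hsplit] at hp
  have hE : (star ψ ⬝ᵥ (bdgHopping (fun x y => (t x y : ℂ)) *ᵥ ψ)).re + (star ψ ⬝ᵥ (V *ᵥ ψ)).re =
      ((bdgHopping fun x y => (t x y : ℂ)) + V).minEnergyOn (szSector N M) := by
    rw [← hsplit, hgs.2.2, dotProduct_smul, h1, smul_eq_mul, mul_one, Complex.ofReal_re]
  have hmid := congrArg (fun A : Matrix (Finset (Orb Λ)) (Finset (Orb Λ)) ℂ => (star ψ ⬝ᵥ (A *ᵥ ψ)).re)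
    (bdgHopping_peierls_add_peierls_neg_add t u)
  simp only [add_mulVec, dotProduct_add, Complex.add_re, smul_mulVec, dotProduct_smul, smul_eq_mul,
    re_star_dotProduct_bdgHopping_real_mulVec] at hmid
  have h2re : ((2 : ℂ) * (star ψ ⬝ᵥ (bdgHopping (fun x y => (t x y : ℂ)) *ᵥ ψ))).re =
      2 * (star ψ ⬝ᵥ (bdgHopping (fun x y => (t x y : ℂ)) *ᵥ ψ)).re := by
    simp [Complex.mul_re]
  have hS : ∑ x : Λ, ∑ y : Λ, ∑ σ : Fin 2, 2 * (t x y * (1 - Real.cos (u x y))) *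
        (star ψ ⬝ᵥ ((creation (orb x σ) * annihilation (orb y σ)) *ᵥ ψ)).re =
      2 * ∑ x : Λ, ∑ y : Λ, ∑ σ : Fin 2, t x y * (1 - Real.cos (u x y)) *
        (star ψ ⬝ᵥ ((creation (orb x σ) * annihilation (orb y σ)) *ᵥ ψ)).re := by
    simp only [Finset.mul_sum, mul_assoc]
  rw [h2re, hS] at hmid
  linarith

end Hopping

/-! ### The nodes hold -/

/-- `ThermalGaugeFunctionBoundNumberConserving` holds (Peierls–Bogoliubov at `±(u + dφ)`, gauge
invariance of the sector partition functions, time reversal, midpoint identity). -/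
theorem thermalGaugeFunctionBoundNumberConserving_holds : ThermalGaugeFunctionBoundNumberConserving := by
  intro Λ _ _ t u ht hu V hV hVc hVg β p _ _ φ
  have hu' : ∀ x y, u y x + (φ x - φ y) = -(u x y + (φ y - φ x)) := fun x y => by rw [hu x y]; ring
  have h := log_partitionFn_toBlock_bdgHopping_peierls_add_ge (u := fun x y => u x y + (φ y - φ x))
    ht hu' hV hVc β p
  have hcov : (phaseGauge fun x => Circle.exp (φ x))ᴴ *
      ((bdgHopping fun x y => (t x y : ℂ) * Complex.exp ((u x y : ℂ) * Complex.I)) + V) *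
      phaseGauge (fun x => Circle.exp (φ x)) =
      (bdgHopping fun x y => (t x y : ℂ) * Complex.exp (((u x y + (φ y - φ x) : ℝ) : ℂ) * Complex.I)) + V := by
    rw [Matrix.mul_add, Matrix.add_mul, conjTranspose_phaseGauge_mul_bdgHopping_peierls_mul_phaseGauge,
      hVg φ]
  rwa [← hcov, partitionFn_toBlock_conjTranspose_phaseGauge_mul_mul_phaseGauge] at h

/-- `GaugeFunctionBoundNumberConserving` holds (Rayleigh at `±(u + dφ)` with the gauged ground state,
gauge invariance of the sector energies, time reversal, midpoint identity). -/
theorem gaugeFunctionBoundNumberConserving_holds : GaugeFunctionBoundNumberConserving := by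
  intro Λ _ _ t u ht hu V hV hVc hVg N M ψ hgs h1 φ
  have hu' : ∀ x y, u y x + (φ x - φ y) = -(u x y + (φ y - φ x)) := fun x y => by rw [hu x y]; ring
  have h := minEnergyOn_szSector_bdgHopping_peierls_add_sub_le (u := fun x y => u x y + (φ y - φ x))
    ht hu' hV hVc N M hgs h1
  have hcov : (phaseGauge fun x => Circle.exp (φ x))ᴴ *
      ((bdgHopping fun x y => (t x y : ℂ) * Complex.exp ((u x y : ℂ) * Complex.I)) + V) *
      phaseGauge (fun x => Circle.exp (φ x)) =
      (bdgHopping fun x y => (t x y : ℂ) * Complex.exp (((u x y + (φ y - φ x) : ℝ) : ℂ) * Complex.I)) + V := by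
    rw [Matrix.mul_add, Matrix.add_mul, conjTranspose_phaseGauge_mul_bdgHopping_peierls_mul_phaseGauge,
      hVg φ]
  rwa [← hcov, minEnergyOn_szSector_phaseGauge_conj] at h

/-- **Node (THEOREM, proved below): the occupation-diagonal class is contained in this class.**
Every real occupation-diagonal interaction `V = diagonal Φ` (the Literature file's / PTR98 §II class:
Hubbard `U`, density–density, site disorder, Zeeman-`z`) is Hermitian, real in the occupation basis and
invariant under every site-phase gauge `W_φ`; so the two nodes above contain
`log_partitionFn_toBlock_bdgHopping_peierls_ge_gaugeFunction` /
`minEnergyOn_szSector_bdgHopping_peierls_sub_le_gaugeFunction`. HONEST FRAMING: bookkeeping edge; no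
claim on H/H₀. -/
@[conjecture] def OccupationDiagonalIsNumberConserving : Prop :=
  ∀ (Λ : Type) [LinearOrder Λ] [Fintype Λ] (Φ : Finset (Orb Λ) → ℝ),
    (diagonal fun s => (Φ s : ℂ)).IsHermitian ∧
      (diagonal fun s => (Φ s : ℂ)).map (starRingEnd ℂ) = diagonal (fun s => (Φ s : ℂ)) ∧
      ∀ φ : Λ → ℝ, (phaseGauge fun x => Circle.exp (φ x))ᴴ * diagonal (fun s => (Φ s : ℂ)) *
        phaseGauge (fun x => Circle.exp (φ x)) = diagonal fun s => (Φ s : ℂ)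

/-- `OccupationDiagonalIsNumberConserving` holds (diagonal algebra; `|e^{iφ}| = 1`). -/
theorem occupationDiagonalIsNumberConserving_holds : OccupationDiagonalIsNumberConserving := by
  intro Λ _ _ Φ
  refine ⟨?_, ?_, fun φ => ?_⟩
  · show (diagonal fun s => (Φ s : ℂ))ᴴ = diagonal fun s => (Φ s : ℂ)
    rw [diagonal_conjTranspose]
    exact congrArg diagonal (funext fun s => Complex.conj_ofReal _)
  · rw [diagonal_map (map_zero _)]
    exact congrArg diagonal (funext fun s => Complex.conj_ofReal _)
  · ext i j
    rw [phaseGauge_eq, conjTranspose_diagonal_inst]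
    simp only [mul_diagonal]
    by_cases h : i = j
    · subst h
      have hunit : ∀ z : Circle, star (z : ℂ) * (z : ℂ) = 1 := fun z => by
        rw [Complex.star_def, ← Complex.normSq_eq_conj_mul_self, Circle.normSq_coe, Complex.ofReal_one]
      rw [diagonal_apply_eq, diagonal_apply_eq, mul_right_comm, hunit, one_mul]
    · rw [diagonal_apply_ne _ h, diagonal_apply_ne _ h, zero_mul, zero_mul]

end Summit.HubbardSuperconductivity.HubbardLadder.Bounds

end
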